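import Literature.NumberTheory.LFunctions.ZetaScrew
import Literature.Analysis.Complex.PositiveKernelContinuation

/-!
# ZetaStringArchWall — definitions: the archimedean wall `Ψ_∅` of Suzuki's screw function and its Kreĭn kernel (column DBR; RH-FREE; defs only)

RH-FREE typed statements of the cell rh-dbr's theory memo TARGET-v7 (§3 / §K.2, rh-dbr-theory g7, 2026-08-26; Lean sketch
`ZetaStringTargets.lean`, namespace `RhDbrTheory.TargetV7`), typed here VERBATIM so that certificates can cite them:
* `archScrew` — the prime-free ("archimedean wall") part `Ψ_∅ := Ψ + Σ_{n ≤ e^{|t|}} Λ(n) n^{-1/2}(|t| − log n)` of Suzuki's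
  screw function `Ψ = zetaScrew` (M. Suzuki, J. Lond. Math. Soc. (2) 108 (2023) = arXiv:2206.03682, (1.1); tree
  `zetaScrew_eq`: `Ψ = arch − primeSum − linear + Lerch`); agrees with `Ψ` on `|t| < log 2`
  (`zetaScrewPrimeSum_eq_zero_of_abs_lt_log_two`);
* `archKernel t u = Ψ_∅(t) + Ψ_∅(u) − Ψ_∅(t − u)` — the Kreĭn kernel of the wall (the chord Gram of the Weil–Kreĭn operator
  `T^∅_ℓ` of ENGINE-TARGETS.md §3 with every prime removed), `ℂ`-valued for `IsPosSemidefKernelOn`;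
* `ArchWallTies ℓ̄` — the wall alone is NOT positive semidefinite on configurations in `(0, ℓ̄)` (ET6 "necessity depth" N = 2:
  `δ(2) = ℓ*(∅) − log 2`, float `ℓ*(∅) ≈ 0.745`); `ArchWallHolds ℓ` — it IS; `ArchWallBracket` = the pair at `0.74 / 0.75`.
Labels: every statement is an RH-FREE finite/structural fact about the explicit function `Ψ_∅` (no zeros of `ζ` enter:
`Ψ_∅` is the closed archimedean germ); `ArchWallTies (3/4)` is proved by a kernel certificate in
`Theorems.ZetaStringArchWallTies`. Nothing here bears on the truth of RH.
-/

noncomputable section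

-- D-0017: `Summit.<S>.<S>.…` is the designed namespace of a single-problem summit.
set_option linter.dupNamespace false

namespace Summit.RiemannHypothesis.RiemannHypothesis.Theorems.ZetaStringArchWall

open Literature.NumberTheory.LFunctions Literature.Analysis.Complex

/-- RH-FREE object: the prime-free ("archimedean wall") part `Ψ_∅ := Ψ + Σ_{n ≤ e^{|t|}} Λ(n) n^{-1/2}(|t| − log n)` of
Suzuki's screw function (`zetaScrew_eq`: `Ψ = arch − primeSum − linear + Lerch`); agrees with `Ψ` on `|t| < log 2`. -/
def archScrew (t : ℝ) : ℝ := zetaScrew t + zetaScrewPrimeSum t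

/-- RH-FREE object: the Kreĭn kernel of the archimedean wall, `Ψ_∅(t) + Ψ_∅(u) − Ψ_∅(t − u)` (as a complex number). -/
def archKernel (t u : ℝ) : ℂ := ((archScrew t + archScrew u - archScrew (t - u) : ℝ) : ℂ)

/-- RH-FREE · ET6 certificate shape (N = 2): the wall alone TIES by one-sided depth `ℓ̄` — the archimedean kernel is not
positive semidefinite on configurations in `(0, ℓ̄)`.  (ET6 float prediction: true for `ℓ̄ = 3/4`, radius `ℓ*(∅) ≈ 0.7453`.) -/
def ArchWallTies (lbar : ℝ) : Prop := ¬ IsPosSemidefKernelOn archKernel (Set.Ioo 0 lbar)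

/-- RH-FREE for `ℓ ≤ log 2` (proved rung `WeilPositivityOn (log 2 / 2)` + `Ψ_∅ = Ψ` below `log 2`); ET6 float: holds up to
`ℓ ≈ 0.745`.  The archimedean kernel IS positive semidefinite on configurations in `(0, ℓ)`. -/
def ArchWallHolds (l : ℝ) : Prop := IsPosSemidefKernelOn archKernel (Set.Ioo 0 l)

/-- The typed bracket ET6 is asked to certify (N = 2 row): holds at `0.74`, ties at `0.75`. -/
def ArchWallBracket : Prop := ArchWallHolds (0.74 : ℝ) ∧ ArchWallTies (3 / 4 : ℝ)

/-- `Ψ_∅` is even. -/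
@[simp] theorem archScrew_neg (t : ℝ) : archScrew (-t) = archScrew t := by
  simp [archScrew]

/-- `Ψ_∅(0) = 0`. -/
@[simp] theorem archScrew_zero : archScrew 0 = 0 := by
  simp [archScrew, zetaScrew_zero, zetaScrewPrimeSum_zero]

/-- On the wall `|t| < log 2`, `Ψ_∅ = Ψ`. -/
theorem archScrew_eq_zetaScrew_of_abs_lt_log_two {t : ℝ} (ht : |t| < Real.log 2) : archScrew t = zetaScrew t := by
  simp [archScrew, zetaScrewPrimeSum_eq_zero_of_abs_lt_log_two ht]

/-- Monotonicity of the negative statement: a tie inside `(0, ℓ̄)` is a tie inside any larger window. -/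
theorem ArchWallTies.mono {l l' : ℝ} (h : ArchWallTies l) (hle : l ≤ l') : ArchWallTies l' :=
  fun h' => h (h'.mono (Set.Ioo_subset_Ioo_right hle))

end Summit.RiemannHypothesis.RiemannHypothesis.Theorems.ZetaStringArchWall

end
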